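import Summits.ResolutionOfSingularities.ResolutionOfSingularities.Theorems.EquisingularLiftEquisingularLiftNatPlanarSmoothingPoint
import Summits.ResolutionOfSingularities.ResolutionOfSingularities.Theorems.EquisingularLiftEquisingularLiftNatCompleteIntersectionLiftNose
import Summits.ResolutionOfSingularities.ResolutionOfSingularities.Theorems.EquisingularLiftEquisingularLiftNatNoseTraceTools
import Summits.ResolutionOfSingularities.ResolutionOfSingularities.Theorems.EquisingularLiftEquisingularLiftNatPlaneCurveSingular
import HarnessLib

/-!
# [OURS · L1 W4.5(b) · EL♮(3) · NU7 §A2 «Σ1 SMOOTHING LEMMA», part 2d] «`ϖ` IS A REGULAR PARAMETER OF THE HOST MODULO THE LETTER»: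
# `Θ_x ϖ ∉ 𝓛_x + 𝔪_x²` at a special-fibre point under a REGULAR point of the reduced hyperplane trace

res-L1-w45b-stub-2 g19 (STUB WORKER 2), desk RULING R70 (iii).  OURS; NOT a statement of any manuscript ([Hironaka2017] is a candidate under
adjudication — nothing of it is asserted here); AI-written, weaker than expert review.  No `sorry`; standard axioms; DEF-FREE.
`--supports stmt-ResolutionOfSingularities-20148 --as helper`, counted 0.  EL♮(3) is NOT proved; resolution in positive characteristic is NOT proved.

WHAT.  `O` a DVR with uniformiser `ϖ`, `θ : O → k` onto a field with `θ ϖ = 0`, `φ = map θ` the graded coefficient map, `g = Proj φ : ℙⁿ_k → ℙⁿ_O`;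
a point `y ∈ D₊(x_d) ⊂ ℙⁿ_k` with `𝒪_{ℙⁿ_k, y}` regular, `x = g y`; a linear form `L̃ ∈ 𝔭_x` over `O` with `φ L̃ ≠ 0`, its letter `𝓛 = (L̃)~`, and
the trace `E := 𝓛 · 𝒪_{ℙⁿ_k}` with `V(E)` REGULAR at the point over `y`.  Then
★ `germ_C_varpi_notMem_stalkIdeal_sup_sq` — the constant chart germ `Θ_x ϖ` is NOT in `𝓛_x + 𝔪_x²` — the hypothesis `hϖL` of part 2c
(`isRegularLocalRing_quotient_stalkIdeal_or`).
PROOF.  `Θ_x ϖ ∉ 𝔪_x²` (part 2b `germ_C_varpi_notMem_sq`); along the stalk map `π` of `g` at `y`: `π (Θ_x ϖ) = 0` and `π (Θ_x L̃) = Θ_y (φ L̃)`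
(✓ `CILift.stalkMap_germ_mk₁`), `E_y = (Θ_y (φ L̃))` (✓ `stalkIdeal_comap_eq_map_stalkMap`, ✓ `CILift.stalkIdeal_projIdealSheaf_span`), so
`𝒪_y ⧸ (Θ_y (φ L̃))` is regular and `Θ_y (φ L̃) ∉ 𝔪_y²` (converse of Matsumura 14.2, ✓ `not_mem_sq_of_isRegularLocalRing_quotient`), whence
`Θ_x L̃ ∉ (Θ_x ϖ) + 𝔪_x²` (part 2a `notMem_ker_sup_sq_of_map_notMem_sq`); the SYMMETRIC TRICK `notMem_span_sup_sq_symm` (two vectors of `𝔪/𝔪²`: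
`u ≠ 0`, `v ∉ ⟨u⟩` ⇒ `u ∉ ⟨v⟩`) concludes.  Two small suppliers of part 3 ride along: `exists_mem_basicOpen_X` (every point of `ℙⁿ_R` lies in a
standard chart) and `exists_linearForm_forall_notMem` (over an INFINITE field a linear form misses any finite set of points of `ℙⁿ_k` — a vector
space over an infinite field is not a finite union of proper subspaces, Mathlib `Submodule.exists_forall_notMem_of_forall_ne_top`).
References (method / index only): H. Matsumura, *Commutative Ring Theory* (1986), Thm. 14.2; R. Hartshorne, *Algebraic Geometry* (1977), II Prop. 5.9.
-/

set_option linter.dupNamespace false -- mandated namespace `Summit.<Summit>.<Problem>` of this single-conjunct summit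
set_option linter.overlappingInstances false -- signatures carry `[IsDomain O] [IsDiscreteValuationRing O]`

noncomputable section

open CategoryTheory AlgebraicGeometry TopologicalSpace IsLocalRing
open MvPolynomial HomogeneousLocalization
open Literature.AlgebraicGeometry.Resolution
open AlgebraicGeometry.Scheme.IdealSheafData
open Summit.ResolutionOfSingularities.ResolutionOfSingularities.Cruxes.EquisingularLift.StrataSplit

namespace Summit.ResolutionOfSingularities.ResolutionOfSingularities.Cruxes.EquisingularLiftNat.Sections.PlanarSmoothing

open Summit.ResolutionOfSingularities.ResolutionOfSingularities.Cruxes.EquisingularLiftNat.Sections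
open Summit.ResolutionOfSingularities.ResolutionOfSingularities.Cruxes.EquisingularLiftNat.Sections.Equinodal

/-! ## The symmetric trick in `𝔪 ⧸ 𝔪²` -/

/-- **Symmetric trick.** In a local ring: if `u ∉ 𝔪²`, `v ∈ 𝔪` and `v ∉ (u) + 𝔪²`, then `u ∉ (v) + 𝔪²` (the images of `u, v` in `𝔪/𝔪²`:
`u ≠ 0` and `v ∉ ⟨u⟩` force `u ∉ ⟨v⟩`). [folklore] -/
theorem notMem_span_sup_sq_symm {B : Type*} [CommRing B] [IsLocalRing B] {u v : B} (hu : u ∉ maximalIdeal B ^ 2)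
    (hv : v ∈ maximalIdeal B) (hvu : v ∉ Ideal.span {u} ⊔ maximalIdeal B ^ 2) : u ∉ Ideal.span {v} ⊔ maximalIdeal B ^ 2 := by
  intro h
  obtain ⟨s, hs, m, hm, hsm⟩ := Submodule.mem_sup.mp h
  obtain ⟨a, rfl⟩ := Ideal.mem_span_singleton'.mp hs
  by_cases ha : IsUnit a
  · obtain ⟨a', ha'⟩ := ha.exists_left_inv
    apply hvu
    have hv' : v = a' * u + -(a' * m) := by linear_combination (-v) * ha' + a' * hsm
    rw [hv']
    exact Submodule.mem_sup.mpr ⟨a' * u, Ideal.mem_span_singleton'.mpr ⟨a', rfl⟩, -(a' * m),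
      neg_mem (Ideal.mul_mem_left _ _ hm), rfl⟩
  · have ham : a ∈ maximalIdeal B := (IsLocalRing.mem_maximalIdeal a).mpr ha
    apply hu
    rw [← hsm]
    exact add_mem (by rw [pow_two]; exact Ideal.mul_mem_mul ham hv) hm

/-! ## Standard charts and linear forms missing finitely many points -/

/-- Every point of `ℙⁿ_R` lies in a standard chart `D₊(x_d)` (the `x_d` generate an ideal containing the irrelevant ideal). [folklore] -/
theorem exists_mem_basicOpen_X {R : Type} [CommRing R] {n : ℕ} :
    letI := MvPolynomial.gradedAlgebra (σ := Fin (n + 1)) (R := R)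
    ∀ y : Proj (homogeneousSubmodule (Fin (n + 1)) R), ∃ d : Fin (n + 1),
      y ∈ Proj.basicOpen (homogeneousSubmodule (Fin (n + 1)) R) (X d) := by
  letI := MvPolynomial.gradedAlgebra (σ := Fin (n + 1)) (R := R)
  intro y
  by_contra h
  simp only [not_exists] at h
  apply y.not_irrelevant_le
  intro f hf
  have hf' : f ∈ Ideal.span (Set.range (X : Fin (n + 1) → MvPolynomial (Fin (n + 1)) R)) := irrelevant_le_span n R hf
  refine Ideal.span_le.mpr ?_ hf'
  rintro _ ⟨i, rfl⟩
  by_contra hi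
  exact h i ((Proj.mem_basicOpen _ _ _).mpr hi)

/-- Over an INFINITE field, some linear form misses any finite set of points of `ℙⁿ_k`: the degree-one parts of finitely many relevant primes are
proper subspaces of `k·x₀ ⊕ … ⊕ k·xₙ`, and a vector space over an infinite field is not a finite union of proper subspaces. [folklore] -/
theorem exists_linearForm_forall_notMem {k : Type} [Field k] [Infinite k] {n : ℕ} :
    letI := MvPolynomial.gradedAlgebra (σ := Fin (n + 1)) (R := k)
    ∀ (S : Set (Proj (homogeneousSubmodule (Fin (n + 1)) k))), S.Finite →
      ∃ lam : MvPolynomial (Fin (n + 1)) k, lam.IsHomogeneous 1 ∧ ∀ y ∈ S, lam ∉ y.asHomogeneousIdeal := by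
  letI := MvPolynomial.gradedAlgebra (σ := Fin (n + 1)) (R := k)
  intro S hS
  haveI : Finite ↥S := hS.to_subtype
  let pS : ↥S → Submodule k ↥(homogeneousSubmodule (Fin (n + 1)) k 1) := fun z =>
    (((z : Proj (homogeneousSubmodule (Fin (n + 1)) k)).asHomogeneousIdeal.toIdeal).restrictScalars k).comap
      (homogeneousSubmodule (Fin (n + 1)) k 1).subtype
  have hpS : ∀ z, pS z ≠ ⊤ := by
    intro z htop
    apply (z : Proj (homogeneousSubmodule (Fin (n + 1)) k)).not_irrelevant_le
    intro f hf
    have hf' : f ∈ Ideal.span (Set.range (X : Fin (n + 1) → MvPolynomial (Fin (n + 1)) k)) := irrelevant_le_span n k hf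
    refine Ideal.span_le.mpr ?_ hf'
    rintro _ ⟨i, rfl⟩
    have hXi : (⟨X i, CILift.X_mem_one' i⟩ : ↥(homogeneousSubmodule (Fin (n + 1)) k 1)) ∈ pS z := by
      rw [htop]; exact Submodule.mem_top
    exact hXi
  obtain ⟨lam, hlam⟩ := Submodule.exists_forall_notMem_of_forall_ne_top pS hpS
  exact ⟨lam, (mem_homogeneousSubmodule 1 _).mp lam.2, fun y hy h => hlam ⟨y, hy⟩ h⟩

/-! ## `Θ_x ϖ ∉ 𝓛_x + 𝔪_x²` -/

variable {O : Type} [CommRing O] [IsDomain O] [IsDiscreteValuationRing O] {ϖ : O} {n : ℕ}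

set_option maxHeartbeats 800000 in -- stalk-ideal computations along the closed immersion `g = Proj φ`
/-- ★ **`ϖ` is a regular parameter of `𝒪_{ℙⁿ_O, x}` modulo the letter `𝓛 = (L̃)~`, at a special-fibre point under a regular point of the reduced
hyperplane trace.**  See the module docstring.  [cite: Matsumura1987, Thm. 14.2] [OURS · NU7 §A2 part 2d] -/
theorem germ_C_varpi_notMem_stalkIdeal_sup_sq (hϖ : Irreducible ϖ) {k : Type} [Field k] (θ : O →+* k) (hθϖ : θ ϖ = 0) (d : Fin (n + 1)) :
    letI := MvPolynomial.gradedAlgebra (σ := Fin (n + 1)) (R := O)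
    letI := MvPolynomial.gradedAlgebra (σ := Fin (n + 1)) (R := k)
    ∀ (φ : homogeneousSubmodule (Fin (n + 1)) O →+*ᵍ homogeneousSubmodule (Fin (n + 1)) k)
    (hφ' : HomogeneousIdeal.irrelevant (homogeneousSubmodule (Fin (n + 1)) k) ≤
      (HomogeneousIdeal.irrelevant (homogeneousSubmodule (Fin (n + 1)) O)).map φ), (∀ s, φ s = MvPolynomial.map θ s) →
    ∀ (y : Proj (homogeneousSubmodule (Fin (n + 1)) k)) (hy : y ∈ Proj.basicOpen (homogeneousSubmodule (Fin (n + 1)) k) (X d))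
      (hx : Proj.map φ hφ' y ∈ Proj.basicOpen (homogeneousSubmodule (Fin (n + 1)) O) (X d)),
    IsRegularLocalRing ((Proj (homogeneousSubmodule (Fin (n + 1)) k)).presheaf.stalk y) →
    ∀ (Lt : MvPolynomial (Fin (n + 1)) O) (hLt : Lt ∈ homogeneousSubmodule (Fin (n + 1)) O 1),
    Lt ∈ (Proj.map φ hφ' y).asHomogeneousIdeal → (φ Lt : MvPolynomial (Fin (n + 1)) k) ≠ 0 →
    ∀ (E : (Proj (homogeneousSubmodule (Fin (n + 1)) k)).IdealSheafData),
    (projIdealSheaf (homogeneousSubmodule (Fin (n + 1)) O) ⟨Ideal.span (Set.range ![Lt]),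
        isHomogeneous_span_of_forall_mem _ _ _ (single_mem Lt hLt)⟩).comap (Proj.map φ hφ') = E →
    ∀ (ye : ↥E.subscheme), E.subschemeι ye = y → IsRegularLocalRing (E.subscheme.presheaf.stalk ye) →
    ((Proj (homogeneousSubmodule (Fin (n + 1)) O)).presheaf.germ (Proj.basicOpen (homogeneousSubmodule (Fin (n + 1)) O) (X d)) (Proj.map φ hφ' y) hx).hom
        ((Proj.awayToSection (homogeneousSubmodule (Fin (n + 1)) O) (X d)).hom
          (mk₁ (homogeneousSubmodule (Fin (n + 1)) O) (CILift.X_mem_one' d) 0 (C ϖ) (isHomogeneous_C _ ϖ))) ∉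
      stalkIdeal (projIdealSheaf (homogeneousSubmodule (Fin (n + 1)) O) ⟨Ideal.span (Set.range ![Lt]),
          isHomogeneous_span_of_forall_mem _ _ _ (single_mem Lt hLt)⟩) (Proj.map φ hφ' y) ⊔
        maximalIdeal ((Proj (homogeneousSubmodule (Fin (n + 1)) O)).presheaf.stalk (Proj.map φ hφ' y)) ^ 2 := by
  classical
  letI := MvPolynomial.gradedAlgebra (σ := Fin (n + 1)) (R := O)
  letI := MvPolynomial.gradedAlgebra (σ := Fin (n + 1)) (R := k)
  intro φ hφ' hφ y hy hx hyreg Lt hLt hLtx hL0 E hE ye hye hEreg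
  subst hE
  haveI := hyreg
  haveI : y.asHomogeneousIdeal.toIdeal.IsPrime := y.isPrime
  -- the coefficient map on the letters
  have hφX : φ (X d) = X d := by rw [hφ, map_X]
  have hφLt : (φ Lt : MvPolynomial (Fin (n + 1)) k) ∈ homogeneousSubmodule (Fin (n + 1)) k 1 := φ.map_mem hLt
  have hφϖ : (φ (C ϖ) : MvPolynomial (Fin (n + 1)) k) = 0 := by rw [hφ, map_C, hθϖ, C_0]
  have hLty : (φ Lt : MvPolynomial (Fin (n + 1)) k) ∈ y.asHomogeneousIdeal := hLtx
  have hxϖ : (C ϖ : MvPolynomial (Fin (n + 1)) O) ∈ (Proj.map φ hφ' y).asHomogeneousIdeal := by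
    change φ (C ϖ) ∈ y.asHomogeneousIdeal
    rw [hφϖ]; exact zero_mem _
  -- the stalk map of `g = Proj φ` at `y` on the chart germs
  let π := ((Proj.map φ hφ').stalkMap y).hom
  have hπLt : π (((Proj (homogeneousSubmodule (Fin (n + 1)) O)).presheaf.germ (Proj.basicOpen (homogeneousSubmodule (Fin (n + 1)) O) (X d))
        (Proj.map φ hφ' y) hx).hom ((Proj.awayToSection (homogeneousSubmodule (Fin (n + 1)) O) (X d)).hom
          (mk₁ (homogeneousSubmodule (Fin (n + 1)) O) (CILift.X_mem_one' d) 1 Lt hLt))) =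
      ((Proj (homogeneousSubmodule (Fin (n + 1)) k)).presheaf.germ (Proj.basicOpen (homogeneousSubmodule (Fin (n + 1)) k) (X d)) y hy).hom
        ((Proj.awayToSection (homogeneousSubmodule (Fin (n + 1)) k) (X d)).hom
          (mk₁ (homogeneousSubmodule (Fin (n + 1)) k) (CILift.X_mem_one' d) 1 (φ Lt) hφLt)) :=
    CILift.stalkMap_germ_mk₁ O φ hφ' d hφX 1 Lt hLt (φ Lt) hφLt rfl y hy hx
  have hπϖ : π (((Proj (homogeneousSubmodule (Fin (n + 1)) O)).presheaf.germ (Proj.basicOpen (homogeneousSubmodule (Fin (n + 1)) O) (X d))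
        (Proj.map φ hφ' y) hx).hom ((Proj.awayToSection (homogeneousSubmodule (Fin (n + 1)) O) (X d)).hom
          (mk₁ (homogeneousSubmodule (Fin (n + 1)) O) (CILift.X_mem_one' d) 0 (C ϖ) (isHomogeneous_C _ ϖ)))) = 0 := by
    have h := CILift.stalkMap_germ_mk₁ O φ hφ' d hφX 0 (C ϖ) (isHomogeneous_C _ ϖ) 0 (zero_mem _) hφϖ y hy hx
    rw [mk₁_zero, map_zero, map_zero] at h
    exact h
  -- `𝓛_x = (Θ_x L̃)` and `E_y = (Θ_y (φ L̃))`
  have hstalkL : stalkIdeal (projIdealSheaf (homogeneousSubmodule (Fin (n + 1)) O) ⟨Ideal.span (Set.range ![Lt]),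
      isHomogeneous_span_of_forall_mem _ _ _ (single_mem Lt hLt)⟩) (Proj.map φ hφ' y) =
      Ideal.span {((Proj (homogeneousSubmodule (Fin (n + 1)) O)).presheaf.germ (Proj.basicOpen (homogeneousSubmodule (Fin (n + 1)) O) (X d))
        (Proj.map φ hφ' y) hx).hom ((Proj.awayToSection (homogeneousSubmodule (Fin (n + 1)) O) (X d)).hom
          (mk₁ (homogeneousSubmodule (Fin (n + 1)) O) (CILift.X_mem_one' d) 1 Lt hLt))} := by
    rw [CILift.stalkIdeal_projIdealSheaf_span (![Lt]) (![1]) (single_mem Lt hLt) d (Proj.map φ hφ' y) hx, Set.range_unique]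
    rfl
  have hstalkE : stalkIdeal ((projIdealSheaf (homogeneousSubmodule (Fin (n + 1)) O) ⟨Ideal.span (Set.range ![Lt]),
      isHomogeneous_span_of_forall_mem _ _ _ (single_mem Lt hLt)⟩).comap (Proj.map φ hφ')) y =
      Ideal.span {((Proj (homogeneousSubmodule (Fin (n + 1)) k)).presheaf.germ (Proj.basicOpen (homogeneousSubmodule (Fin (n + 1)) k) (X d)) y hy).hom
        ((Proj.awayToSection (homogeneousSubmodule (Fin (n + 1)) k) (X d)).hom
          (mk₁ (homogeneousSubmodule (Fin (n + 1)) k) (CILift.X_mem_one' d) 1 (φ Lt) hφLt))} := by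
    rw [stalkIdeal_comap_eq_map_stalkMap, hstalkL, Ideal.map_span, Set.image_singleton, ← hπLt]
  -- `𝒪_y ⧸ (Θ_y (φ L̃))` is regular, so `Θ_y (φ L̃) ∉ 𝔪_y²`
  have hq : IsRegularLocalRing (((Proj (homogeneousSubmodule (Fin (n + 1)) k)).presheaf.stalk y : Type) ⧸
      Ideal.span {((Proj (homogeneousSubmodule (Fin (n + 1)) k)).presheaf.germ (Proj.basicOpen (homogeneousSubmodule (Fin (n + 1)) k) (X d)) y hy).hom
        ((Proj.awayToSection (homogeneousSubmodule (Fin (n + 1)) k) (X d)).hom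
          (mk₁ (homogeneousSubmodule (Fin (n + 1)) k) (CILift.X_mem_one' d) 1 (φ Lt) hφLt))}) := by
    rw [← hstalkE]
    exact (isRegularLocalRing_subscheme_stalk_iff_of_eq _ ye y hye).mp hEreg
  have hne : ((Proj (homogeneousSubmodule (Fin (n + 1)) k)).presheaf.germ (Proj.basicOpen (homogeneousSubmodule (Fin (n + 1)) k) (X d)) y hy).hom
        ((Proj.awayToSection (homogeneousSubmodule (Fin (n + 1)) k) (X d)).hom
          (mk₁ (homogeneousSubmodule (Fin (n + 1)) k) (CILift.X_mem_one' d) 1 (φ Lt) hφLt)) ≠ 0 := by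
    intro h0
    have hv := val_stalkIso'_germ_mk₁ d 1 (φ Lt : MvPolynomial (Fin (n + 1)) k) hφLt y hy
    have hz : (Proj.stalkIso' (homogeneousSubmodule (Fin (n + 1)) k) y
        (((Proj (homogeneousSubmodule (Fin (n + 1)) k)).presheaf.germ (Proj.basicOpen (homogeneousSubmodule (Fin (n + 1)) k) (X d)) y hy).hom
          ((Proj.awayToSection (homogeneousSubmodule (Fin (n + 1)) k) (X d)).hom
            (mk₁ (homogeneousSubmodule (Fin (n + 1)) k) (CILift.X_mem_one' d) 1 (φ Lt) hφLt)))).val = 0 := by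
      rw [h0]
      exact (congrArg HomogeneousLocalization.val (map_zero (Proj.stalkIso' (homogeneousSubmodule (Fin (n + 1)) k) y))).trans
        HomogeneousLocalization.val_zero
    rw [hz, zero_mul] at hv
    exact hL0 (IsLocalization.injective (Localization.AtPrime y.asHomogeneousIdeal.toIdeal)
      (Ideal.primeCompl_le_nonZeroDivisors y.asHomogeneousIdeal.toIdeal) (by rw [map_zero]; exact hv.symm))
  have hmemy := germ_mk₁_mem_maximalIdeal_of_mem d 1 (φ Lt : MvPolynomial (Fin (n + 1)) k) hφLt y hy hLty
  have hnot2 := not_mem_sq_of_isRegularLocalRing_quotient hmemy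
    (by haveI := isDomain_of_isRegularLocalRing ((Proj (homogeneousSubmodule (Fin (n + 1)) k)).presheaf.stalk y : Type)
        exact (IsRegular.of_ne_zero hne).left.isSMulRegular) hq
  -- pull back along `π`: `Θ_x L̃ ∉ ker π + 𝔪_x² ⊇ (Θ_x ϖ) + 𝔪_x²`
  haveI : IsLocalHom π := inferInstanceAs (IsLocalHom ((Proj.map φ hφ').stalkMap y).hom)
  have hnotx := notMem_ker_sup_sq_of_map_notMem_sq π (by rw [hπLt]; exact hnot2)
  have hle : Ideal.span {((Proj (homogeneousSubmodule (Fin (n + 1)) O)).presheaf.germ (Proj.basicOpen (homogeneousSubmodule (Fin (n + 1)) O) (X d))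
        (Proj.map φ hφ' y) hx).hom ((Proj.awayToSection (homogeneousSubmodule (Fin (n + 1)) O) (X d)).hom
          (mk₁ (homogeneousSubmodule (Fin (n + 1)) O) (CILift.X_mem_one' d) 0 (C ϖ) (isHomogeneous_C _ ϖ)))} ⊔
        maximalIdeal ((Proj (homogeneousSubmodule (Fin (n + 1)) O)).presheaf.stalk (Proj.map φ hφ' y)) ^ 2 ≤
      RingHom.ker π ⊔ maximalIdeal ((Proj (homogeneousSubmodule (Fin (n + 1)) O)).presheaf.stalk (Proj.map φ hφ' y)) ^ 2 :=
    sup_le_sup_right ((Ideal.span_singleton_le_iff_mem _).mpr (by rw [RingHom.mem_ker]; exact hπϖ)) _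
  -- the symmetric trick
  rw [hstalkL]
  exact notMem_span_sup_sq_symm (germ_C_varpi_notMem_sq hϖ d (Proj.map φ hφ' y) hx hxϖ)
    (germ_mk₁_mem_maximalIdeal_of_mem d 1 Lt hLt (Proj.map φ hφ' y) hx hLtx) (fun h => hnotx (hle h))

end Summit.ResolutionOfSingularities.ResolutionOfSingularities.Cruxes.EquisingularLiftNat.Sections.PlanarSmoothing

end
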